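import Summits.CriticalPhenomena.PercolationContinuityZ3.Theorems.PercNearOneGluingNoHeavyLowerTailHullPortTANWithin
import HarnessLib

/-!
# `NoHeavyLowerTail` (stmt-CriticalPhenomena-4575) — the SET-OBSERVER marker dominance lemma (Kozma–Nitzan Question 9 at `|A| = 3`: the last atom)

Support file (prover `prim-hp-7`; `--supports stmt-CriticalPhenomena-4575`); no definitions, named facts or sorries.
Assembly of blueprint steps B2–B4 of the coupling seat's programme (prim-cplus-coupling A5-COUPLING-gen13.md §5; census
MDL-SET 0 / 4,600; pencil proof = prim-hp-7's `T_A` induction, HP7-MDLX-PROOF.md, set-observer changes refereed in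
FROM-prim-hp-7-g29-REFEREE-MDLSET.md):
* `HullPort.setMarkerDominanceAvoid` — for the owner `s`, an avoided set `X`, a marker `y ≠ s`, an observer SET `N` and every
  monotone `F` of the open edge cluster of `s`, with `D = {s ↮ X}`, `Y = {s ↔ y}`, `O = {s ↔ N} ∩ {N ↮ X}` and
  `cov_D(F, 1_E) = μ(D) ∫_{D∩E} F − (∫_D F) μ(D ∩ E)`:
  `μ(y ↮ s,X; y ↔ N; N ↮ s,X) · cov_D(F, 1_Y) ≤ μ(y ↮ s,X) · cov_D(F, 1_O)`.
  Proof: prim-lit-3's reduction theorem `BHK2006_clusterConditionalCov_nonneg_of_within_of_forall_nondegenerate` with the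
  conditional test function `h_p = b_p ζ̄_N − a^N_p 1{y ∈ V(·)}` (`…TANWithinDefs`), whose hypothesis is
  `HullPort.withinD_setObs_nonneg` (`…TANWithin`), and the tower identity `HullPort.zetaN_towerS` to return from `ζ̄_N` to
  `1_O`.  For `N = {z}` (`z ∉ X ∪ {s}`) it is `CovTau.markerDominanceAvoid` with the extra separation `{z ↮ s, X}`.
* `HullPort.setMarkerDominance_hcov` — the case `X = {z}` for a monotone function of the open VERTEX cluster, literally the
  hypothesis `hcov` of the coupling seat's `Q7Psi.hx_set_of_setMDL` (with `(x, y, z, N)` there `= (s, y, z, N)` here), so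
  that (H_x), (H_y) and, by `Q7Psi.gpsi_three_set_of_halves`, (GΨ₃) for a set of observers follow.
[cite: VandenbergHaggstromKahn2005, Thm. 1.3 (p. 6), Thms 1.4–1.5 (p. 7), §2.1 pp. 9–13]
[cite: KozmaNitzan2024, §5.1 (pp. 31–32), Question 9 (p. 36)] [cite: Gladkov2024, Thm. 3.2 (via `HullPort.Pv_holds`)]
-/

noncomputable section

namespace Summit.CriticalPhenomena.PercolationContinuityZ3.Theorems

open MeasureTheory Set Literature.Probability.LatticeModels Literature.Probability.Percolation
open scoped Classical

variable {V : Type*}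

namespace HullPort

open LonePortSum LonePortSumGeneral BHK2006 DecisionTree KNPreFKG

section SetMDL

variable [Fintype V]

/-- **The set-observer marker dominance lemma** (with an avoided set).  Owner `s`, avoided set `X`, marker `y ≠ s`,
observer set `N`, `F` monotone on the open edge cluster of `s`; `D = {s ↮ X}`, `Y = {s ↔ y}`, `O = {s ↔ N} ∩ {N ↮ X}`:
`μ(y ↮ s,X; y ↔ N; N ↮ s,X) · [μ(D) ∫_{D∩Y} F − (∫_D F) μ(D∩Y)] ≤ μ(y ↮ s,X) · [μ(D) ∫_{D∩O} F − (∫_D F) μ(D∩O)]`.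
(blueprint B2–B4 of prim-cplus-coupling A5-COUPLING-gen13.md; prim-hp-7's `T_A` induction)
[cite: VandenbergHaggstromKahn2005, Thm. 1.3 (p. 6), Thms 1.4–1.5 (p. 7), §2.1 pp. 9–13 — corollaries]
[cite: KozmaNitzan2024, Question 9 (p. 36)] -/
theorem setMarkerDominanceAvoid (w : Sym2 V → unitInterval) (s y : V) (N X : Set V) (hsy : s ≠ y)
    (F : Set (Sym2 V) → ℝ) (hF : Monotone F) :
    (prodBernoulli w).real (avoidEv y (insert s X) ∩ (connS N y ∩ sepEv N (insert s X))) *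
        ((prodBernoulli w).real (avoidEv s X) *
            (∫ ω in avoidEv s X ∩ openConn s y, F (openEdgeCluster ω s) ∂(prodBernoulli w)) -
          (∫ ω in avoidEv s X, F (openEdgeCluster ω s) ∂(prodBernoulli w)) *
            (prodBernoulli w).real (avoidEv s X ∩ openConn s y)) ≤
      (prodBernoulli w).real (avoidEv y (insert s X)) *
        ((prodBernoulli w).real (avoidEv s X) *
            (∫ ω in avoidEv s X ∩ (connS N s ∩ sepEv N X), F (openEdgeCluster ω s) ∂(prodBernoulli w)) -
          (∫ ω in avoidEv s X, F (openEdgeCluster ω s) ∂(prodBernoulli w)) *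
            (prodBernoulli w).real (avoidEv s X ∩ (connS N s ∩ sepEv N X))) := by
  classical
  -- `D` in the reduction theorem's form
  have hDeq : {ω : BondConfig V | ∀ x ∈ X, ¬ (openGraph ω).Reachable s x} = avoidEv s X := rfl
  -- the test functions `h_q = b_q ζ̄_N − a^N_q χ_y`, continuous in the weights
  set h : (Sym2 V → unitInterval) → Set (Sym2 V) → ℝ := fun q A =>
    tab (fun e => (q e : ℝ)) s y X * zetaBarN (fun e => (q e : ℝ)) s N X A -
      taaN (fun e => (q e : ℝ)) s y N X * ind {A : Set (Sym2 V) | y = s ∨ ∃ e ∈ A, y ∈ e} A with hh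
  have hcont : ∀ C, Continuous fun q => h q C := by
    intro C
    simp only [hh, tab, taaN, zetaBarN]
    refine Continuous.sub (Continuous.mul ?_ (continuous_const.mul ?_)) (Continuous.mul ?_ continuous_const)
    · exact continuous_finsetSum _ fun ω _ => (continuous_weight ω).mul continuous_const
    · exact continuous_finsetSum _ fun ω _ => (continuous_weight ω).mul continuous_const
    · exact continuous_finsetSum _ fun ω _ => (continuous_weight ω).mul continuous_const
  -- the hypothesis of the reduction theorem
  have hR : ∀ p : Sym2 V → unitInterval, (∀ e, 0 < p e ∧ p e < 1) →
      ∀ g : Set (Sym2 V) → ℝ, Monotone g → (∀ C, 0 ≤ g C) →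
      0 ≤ ∫ ω in {ω : BondConfig V | ∀ x ∈ X, ¬ (openGraph ω).Reachable s x},
        ((∫ η, g (openEdgeCluster (η \ {e | ∃ v ∈ e, ∃ x ∈ X, (openGraph ω).Reachable x v}) s) *
              h p (openEdgeCluster (η \ {e | ∃ v ∈ e, ∃ x ∈ X, (openGraph ω).Reachable x v}) s)
            ∂(prodBernoulli p)) -
          (∫ η, g (openEdgeCluster (η \ {e | ∃ v ∈ e, ∃ x ∈ X, (openGraph ω).Reachable x v}) s)
            ∂(prodBernoulli p)) *
          (∫ η, h p (openEdgeCluster (η \ {e | ∃ v ∈ e, ∃ x ∈ X, (openGraph ω).Reachable x v}) s)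
            ∂(prodBernoulli p))) ∂(prodBernoulli p) := by
    intro p hp g hg hg0
    have hp1 : ∀ e, (p e : ℝ) < 1 := fun e => by exact_mod_cast (hp e).2
    have hwithin : ∫ ω in {ω : BondConfig V | ∀ x ∈ X, ¬ (openGraph ω).Reachable s x},
        ((∫ η, g (openEdgeCluster (η \ {e | ∃ v ∈ e, ∃ x ∈ X, (openGraph ω).Reachable x v}) s) *
              h p (openEdgeCluster (η \ {e | ∃ v ∈ e, ∃ x ∈ X, (openGraph ω).Reachable x v}) s)
            ∂(prodBernoulli p)) -
          (∫ η, g (openEdgeCluster (η \ {e | ∃ v ∈ e, ∃ x ∈ X, (openGraph ω).Reachable x v}) s)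
            ∂(prodBernoulli p)) *
          (∫ η, h p (openEdgeCluster (η \ {e | ∃ v ∈ e, ∃ x ∈ X, (openGraph ω).Reachable x v}) s)
            ∂(prodBernoulli p))) ∂(prodBernoulli p) =
        withinD (fun e => (p e : ℝ)) {s} X (avoidEv s X) g (h p) := by
      rw [withinD, hDeq, setIntegral_eq_sum p (avoidEv s X)]
      refine Finset.sum_congr rfl fun ω _ => ?_
      rw [condCov, integral_sdiff_eq_condS p s X (fun A => g A * h p A) ω, integral_sdiff_eq_condS p s X g ω,
        integral_sdiff_eq_condS p s X (h p) ω]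
    rw [hwithin]
    exact withinD_setObs_nonneg p hp1 s y hsy N X g hg hg0
  have main := BHK2006_clusterConditionalCov_nonneg_of_within_of_forall_nondegenerate w s X h hcont hR F hF
  rw [hDeq] at main
  -- unfold `h_w` inside the two integrals (everything as finite sums)
  have hcE : tab (fun e => (w e : ℝ)) s y X = (prodBernoulli w).real (avoidEv y (insert s X)) := by
    rw [measureReal_eq_sum]; rfl
  have hca : taaN (fun e => (w e : ℝ)) s y N X =
      (prodBernoulli w).real (avoidEv y (insert s X) ∩ (connS N y ∩ sepEv N (insert s X))) := by
    rw [measureReal_eq_sum]; rfl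
  -- `∫_D F ζ̄ = ∫_{D∩O} F`, `∫_D ζ̄ = μ(D∩O)` (tower), `∫_D F χ = ∫_{D∩Y} F`, `∫_D χ = μ(D∩Y)`
  have hO : ∀ ω : BondConfig V, ind (hitN s N) (openEdgeCluster ω s) * ind (missN N X) (setCl ω X) =
      ind (connS N s ∩ sepEv N X) ω := by
    intro ω; rw [ind_hitN_openEdgeCluster, ind_missN_setCl, ind_inter]
  have i1 : ∑ ω, weight (fun e => (w e : ℝ)) ω * (F (openEdgeCluster ω s) *
      zetaBarN (fun e => (w e : ℝ)) s N X (openEdgeCluster ω s) * ind (avoidEv s X) ω) =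
      ∫ ω in avoidEv s X ∩ (connS N s ∩ sepEv N X), F (openEdgeCluster ω s) ∂(prodBernoulli w) := by
    rw [setIntegral_eq_sum w (avoidEv s X ∩ (connS N s ∩ sepEv N X)), ← zetaN_towerS w s N X F]
    refine Finset.sum_congr rfl fun ω _ => ?_
    simp only [hO ω, ind_inter]; ring
  have i2 : ∑ ω, weight (fun e => (w e : ℝ)) ω * (zetaBarN (fun e => (w e : ℝ)) s N X (openEdgeCluster ω s) * ind (avoidEv s X) ω) =
      (prodBernoulli w).real (avoidEv s X ∩ (connS N s ∩ sepEv N X)) := by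
    rw [measureReal_eq_sum w (avoidEv s X ∩ (connS N s ∩ sepEv N X))]
    have := zetaN_towerS w s N X fun _ => 1
    simp only [one_mul] at this
    rw [← this]
    refine Finset.sum_congr rfl fun ω _ => ?_
    simp only [hO ω, ind_inter]; ring
  have i3 : ∑ ω, weight (fun e => (w e : ℝ)) ω * (F (openEdgeCluster ω s) *
      ind {A : Set (Sym2 V) | y = s ∨ ∃ e ∈ A, y ∈ e} (openEdgeCluster ω s) * ind (avoidEv s X) ω) =
      ∫ ω in avoidEv s X ∩ openConn s y, F (openEdgeCluster ω s) ∂(prodBernoulli w) := by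
    rw [setIntegral_eq_sum w (avoidEv s X ∩ openConn s y)]
    refine Finset.sum_congr rfl fun ω _ => ?_
    simp only [ind_chiSet_openEdgeCluster, ind_inter]; ring
  have i4 : ∑ ω, weight (fun e => (w e : ℝ)) ω *
      (ind {A : Set (Sym2 V) | y = s ∨ ∃ e ∈ A, y ∈ e} (openEdgeCluster ω s) * ind (avoidEv s X) ω) =
      (prodBernoulli w).real (avoidEv s X ∩ openConn s y) := by
    rw [measureReal_eq_sum w (avoidEv s X ∩ openConn s y)]
    refine Finset.sum_congr rfl fun ω _ => ?_
    simp only [ind_chiSet_openEdgeCluster, ind_inter]; ring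
  have c1 : ∫ ω in avoidEv s X, F (openEdgeCluster ω s) * h w (openEdgeCluster ω s) ∂(prodBernoulli w) =
      tab (fun e => (w e : ℝ)) s y X *
          (∫ ω in avoidEv s X ∩ (connS N s ∩ sepEv N X), F (openEdgeCluster ω s) ∂(prodBernoulli w)) -
        taaN (fun e => (w e : ℝ)) s y N X * ∫ ω in avoidEv s X ∩ openConn s y, F (openEdgeCluster ω s) ∂(prodBernoulli w) := by
    rw [← i1, ← i3, setIntegral_eq_sum w (avoidEv s X), Finset.mul_sum, Finset.mul_sum, ← Finset.sum_sub_distrib]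
    refine Finset.sum_congr rfl fun ω _ => ?_
    simp only [hh]
    ring
  have c2 : ∫ ω in avoidEv s X, h w (openEdgeCluster ω s) ∂(prodBernoulli w) =
      tab (fun e => (w e : ℝ)) s y X * (prodBernoulli w).real (avoidEv s X ∩ (connS N s ∩ sepEv N X)) -
        taaN (fun e => (w e : ℝ)) s y N X * (prodBernoulli w).real (avoidEv s X ∩ openConn s y) := by
    rw [← i2, ← i4, setIntegral_eq_sum w (avoidEv s X), Finset.mul_sum, Finset.mul_sum, ← Finset.sum_sub_distrib]
    refine Finset.sum_congr rfl fun ω _ => ?_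
    simp only [hh]
    ring
  rw [c1, c2, hcE, hca] at main
  nlinarith [main, measureReal_nonneg (μ := prodBernoulli w) (s := avoidEv s X)]

omit [Fintype V] in
/-- `{y ↮ x, z} ∩ {y ↔ N} ∩ {N ↮ x, z} = {y ↔ N} ∩ {x ↮ N} ∩ {z ↮ N}`. [folklore] -/
theorem taaNEv_pair_eq (x y z : V) (N : Set V) :
    (avoidEv y (insert x ({z} : Set V)) ∩ (connS N y ∩ sepEv N (insert x ({z} : Set V))) : Set (Set (Sym2 V))) =
      {ω : BondConfig V | ∃ n ∈ N, (openGraph ω).Reachable y n} ∩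
        ({ω | ∀ n ∈ N, ¬ (openGraph ω).Reachable x n} ∩ {ω | ∀ n ∈ N, ¬ (openGraph ω).Reachable z n}) := by
  ext ω
  simp only [avoidEv, connS, sepEv, Set.mem_inter_iff, Set.mem_setOf_eq, Set.mem_insert_iff,
    Set.mem_singleton_iff, forall_eq_or_imp, forall_eq]
  constructor
  · rintro ⟨_, hN, hsep⟩
    exact ⟨hN, fun n hn h => (hsep n hn).1 h.symm, fun n hn h => (hsep n hn).2 h.symm⟩
  · rintro ⟨⟨n, hn, hyn⟩, hx, hz⟩
    refine ⟨⟨fun h => hx n hn (h.symm.trans hyn), fun h => hz n hn (h.symm.trans hyn)⟩, ⟨n, hn, hyn⟩,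
      fun n' hn' => ⟨fun h => hx n' hn' h.symm, fun h => hz n' hn' h.symm⟩⟩

omit [Fintype V] in
/-- `{y ↮ x, z}` written with `avoidEv`. [folklore] -/
theorem avoidEv_pair_eq (x y z : V) :
    (avoidEv y (insert x ({z} : Set V)) : Set (Set (Sym2 V))) =
      {ω : BondConfig V | ¬ (openGraph ω).Reachable y x} ∩ {ω | ¬ (openGraph ω).Reachable y z} := by
  ext ω
  simp only [avoidEv, Set.mem_inter_iff, Set.mem_setOf_eq, Set.mem_insert_iff, Set.mem_singleton_iff,
    forall_eq_or_imp, forall_eq]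

omit [Fintype V] in
/-- `{x ↮ z}` written with `avoidEv`. [folklore] -/
theorem avoidEv_singleton_eq (x z : V) :
    (avoidEv x ({z} : Set V) : Set (Set (Sym2 V))) = {ω : BondConfig V | ¬ (openGraph ω).Reachable x z} := by
  ext ω
  simp only [avoidEv, Set.mem_setOf_eq, Set.mem_singleton_iff, forall_eq]

omit [Fintype V] in
/-- `{x ↮ z} ∩ ({x ↔ N} ∩ {N ↮ z}) = {x ↔ N} ∩ {z ↮ N}`. [folklore] -/
theorem avoidEv_inter_obs_eq (x z : V) (N : Set V) :
    (avoidEv x ({z} : Set V) ∩ (connS N x ∩ sepEv N ({z} : Set V)) : Set (Set (Sym2 V))) =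
      {ω : BondConfig V | ∃ n ∈ N, (openGraph ω).Reachable x n} ∩ {ω | ∀ n ∈ N, ¬ (openGraph ω).Reachable z n} := by
  rw [sepEv_singleton_eq, avoidEv_singleton_eq]
  ext ω
  simp only [connS, Set.mem_inter_iff, Set.mem_setOf_eq]
  constructor
  · rintro ⟨_, hN, hz⟩
    exact ⟨hN, hz⟩
  · rintro ⟨⟨n, hn, hxn⟩, hz⟩
    exact ⟨fun h => hz n hn (h.symm.trans hxn), ⟨n, hn, hxn⟩, hz⟩

/-- **The hypothesis `hcov` of `Q7Psi.hx_set_of_setMDL`** (coupling seat, `…Q7PsiSetObserverHalf`): the set-observer marker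
dominance lemma for the strong relay `x`, the other strong relay `y`, the weak relay `z` and the observer set `N`, for every
monotone function of the open vertex cluster of `x` — `setMarkerDominanceAvoid` at `(s, X) = (x, {z})`.  With it, (H_x) (and
(H_y) by symmetry) hold at every admissible `t`, hence (GΨ₃) for a set of observers (`Q7Psi.gpsi_three_set_of_halves`).
[cite: KozmaNitzan2024, §5.1 (pp. 31–32), Question 9 (p. 36)] [cite: VandenbergHaggstromKahn2005, Thms 1.3–1.5 (pp. 6–7), §2.1] -/
theorem setMarkerDominance_hcov (w : Sym2 V → unitInterval) (x y z : V) (N : Set V) (hxy : x ≠ y)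
    (F : Set V → ℝ) (hF : ∀ S T : Set V, S ⊆ T → F S ≤ F T) :
    (prodBernoulli w).real ({ω : BondConfig V | ∃ n ∈ N, (openGraph ω).Reachable y n} ∩
            ({ω | ∀ n ∈ N, ¬ (openGraph ω).Reachable x n} ∩ {ω | ∀ n ∈ N, ¬ (openGraph ω).Reachable z n})) *
        ((prodBernoulli w).real {ω : BondConfig V | ¬ (openGraph ω).Reachable x z} *
            (∫ ω in openConn x y ∩ {ω | ¬ (openGraph ω).Reachable x z}, F (openCluster ω x) ∂(prodBernoulli w)) -
          (prodBernoulli w).real (openConn x y ∩ {ω | ¬ (openGraph ω).Reachable x z}) *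
            ∫ ω in {ω : BondConfig V | ¬ (openGraph ω).Reachable x z}, F (openCluster ω x) ∂(prodBernoulli w)) ≤
      (prodBernoulli w).real ({ω : BondConfig V | ¬ (openGraph ω).Reachable y x} ∩
          {ω | ¬ (openGraph ω).Reachable y z}) *
        ((prodBernoulli w).real {ω : BondConfig V | ¬ (openGraph ω).Reachable x z} *
            (∫ ω in {ω : BondConfig V | ∃ n ∈ N, (openGraph ω).Reachable x n} ∩
              {ω | ∀ n ∈ N, ¬ (openGraph ω).Reachable z n}, F (openCluster ω x) ∂(prodBernoulli w)) -
          (prodBernoulli w).real ({ω : BondConfig V | ∃ n ∈ N, (openGraph ω).Reachable x n} ∩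
              {ω | ∀ n ∈ N, ¬ (openGraph ω).Reachable z n}) *
            ∫ ω in {ω : BondConfig V | ¬ (openGraph ω).Reachable x z}, F (openCluster ω x) ∂(prodBernoulli w)) := by
  have key := setMarkerDominanceAvoid w x y N ({z} : Set V) hxy (fun C => F {a | a = x ∨ ∃ e ∈ C, a ∈ e})
    (monotone_clusterFun x F hF)
  simp only [clusterFun_openEdgeCluster] at key
  rw [taaNEv_pair_eq, avoidEv_pair_eq, avoidEv_inter_obs_eq, avoidEv_singleton_eq, Set.inter_comm _ (openConn x y)]
    at key
  linarith [key]

end SetMDL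

end HullPort

end Summit.CriticalPhenomena.PercolationContinuityZ3.Theorems
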